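import Mathlib
import Summits.Langlands.Langlands.Theses.CapacityClassicality
import Literature.NumberTheory.Automorphic.UnboundedDenominators
import Literature.NumberTheory.ModularForms.SturmCongruenceBound
import Literature.NumberTheory.EllipticCurves.ModularCurveKleinJ
import Literature.NumberTheory.EllipticCurves.KleinJIntegralQExpansion
import Summits.Langlands.Langlands.Theorems.CapacityClassicalityIntegralOverconvergentIsCongruenceStubSupNormOfSturm
import Summits.Langlands.Langlands.Theorems.CapacityClassicalityIntegralOverconvergentIsCongruenceStubKatzSturm
import Summits.Langlands.Langlands.Theorems.CapacityClassicalityIntegralOverconvergentIsCongruenceStubAuxPoly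
import Summits.Langlands.Langlands.Theorems.CapacityClassicalityIntegralOverconvergentIsCongruenceStubKatzGain
import Summits.Langlands.Langlands.Theorems.CapacityClassicalityIntegralOverconvergentIsCongruenceStubAnalyticPackaging
import Summits.Langlands.Langlands.Theorems.CapacityClassicalityIntegralOverconvergentIsCongruenceStubMonodromy
import Summits.Langlands.Langlands.Theorems.CapacityClassicalityIntegralOverconvergentIsCongruenceStubModularOfInvariant
import Summits.Langlands.Langlands.Theorems.CapacityClassicalityIntegralOverconvergentIsCongruenceStubCongruenceEndgame

/-!
# Line `Sketch` (card `sturm-is-capacity`) — skeleton for crux `IntegralOverconvergentIsCongruence`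

Crux item stmt-Langlands-8457, route `CapacityClassicality`, decl
`Summit.Langlands.Langlands.Theses.CapacityClassicality.IntegralOverconvergentIsCongruence` (α).

Composition (`IntegralOverconvergentIsCongruence_of`, proved below modulo the stubs):

* `stub_katzSturm` (K1, p-adic gain): a q-series carrying a Katz datum of weight `w`, rate `r`,
  constant `C` on `Γ₁(N)` and vanishing below order `M` has
  `‖ι⁻¹ a_M‖ ≤ C · p^{(r/(p-1))·(w + 12 − 12(M+1)/μ)}`, `μ = [SL₂(ℤ) : Γ₁(N)]`; input: the sup-norm
  Sturm bound along `ι` for CUSP forms on `Γ₁(N)` = `stub_supNormOfSturm`, itself from the NAMED FACT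
  `stub_sturmModPrime` (Sturm 1987 Thm 1 mod `p` over `ℤ`, to be vendored under Literature) and the
  Deligne–Serre integral span of `S_W(Γ₁(N))` (PROVED in the tree:
  `DeligneSerre1974_span_integralLattice1_holds`).
* `stub_katzGain` (K4 + bookkeeping): the crux's Katz datum for `g` propagates to every auxiliary
  form `F_P = P(E₄³, Δ; g¹²Δ^{k⁻}, Δ^{k⁺})` and, fed through K1, yields the gain
  `‖ι⁻¹σ₀ a_M(F_P)‖ ≤ A·B^{D₁+D₂}·R^{-M}` with `R > 1`.
* `stub_auxPoly` (transcendence core, the lead's stub): Siegel over `𝓞_E` + coefficient bounds at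
  every complex embedding (radius ≥ 1) + Liouville through `N_{E/ℚ}` ⇒ some `P ≠ 0` has `F_P = 0`.
* `stub_analyticPackaging`: q-series identities ⇒ identities of holomorphic functions on `ℍ`
  (`g(τ) = Σ σ₀(aₙ) qⁿ`, `y = g¹²/Δᵏ`, `Σ c_{ij} j(τ)ⁱ y(τ)ʲ = 0`).
* `stub_monodromy`: a holomorphic 1-periodic `y` algebraic over `ℂ(j)` is invariant under a
  finite-index `Γ' ∋ T` and every `y ∘ γ` has exponential growth at `i∞`.
* `stub_modularOfInvariant`: from that, `g·Δᵐ` is a `ModularForm Γ'' (k + 12m)` for a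
  finite-index `Γ'' ∋ T`, with q-expansion `(Σ σ₀(aₙ)qⁿ)·Δᵐ`.
* `stub_congruenceEndgame`: Calegari–Dimitrov–Tang (NAMED FACT `stub_unboundedDenominators` =
  `CalegariDimitrovTang2025_unboundedDenominators_algInt`) + `⟨Γ(M), T⟩ = Γ₁(M)` ⇒ a
  `ModularForm (Gamma1 M) (k + 12m)` with the same q-expansion.

Ten registered stubs. STATUS (2026-08-16, lead cycle 1): all eight provable stubs are LANDED as
theorems of `Summit.Langlands.Langlands.Theorems.CapacityClassicality` (files
`…Theorems/CapacityClassicalityIntegralOverconvergentIsCongruenceStub*.lean`: supNormOfSturm p104489,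
katzSturm p105340, katzGain p106617, auxPoly p106398, analyticPackaging p104515, monodromy p104767,
modularOfInvariant p104576, congruenceEndgame p104238) and are referenced below; the only `sorry`s left
are the two NAMED FACTS `stub_sturmModPrime` (Sturm 1987, Thm 1, mod `p`) and
`stub_unboundedDenominators` (Calegari–Dimitrov–Tang) — the line closes the crux MODULO them. The
conditional assembly lands as `…Theorems/CapacityClassicalityIntegralOverconvergentIsCongruence.lean`.
-/

open scoped MatrixGroups Manifold Topology
open UpperHalfPlane CongruenceSubgroup Metric PowerSeries
open Literature.NumberTheory.Automorphic
open Literature.NumberTheory.EllipticCurves Literature.NumberTheory.EllipticCurves.ModularForms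

noncomputable section

namespace Summit.Langlands.Langlands.Cruxes.IntegralOverconvergentIsCongruence.Sketch

/-! ## Stubs -/

/-- **Named fact (do not staff) — Sturm's congruence bound mod `p` for `Γ₁(N)`, `p ∤ N`.** A cusp
form `f ∈ S_k(Γ₁(N))` with rational-integer q-expansion coefficients `zₙ` such that `p ∣ zₙ` for
all `n ≤ k·[SL₂(ℤ):Γ₁(N)]/12` has `p ∣ zₙ` for every `n` (J. Sturm, *On the congruence of modular
forms*, LNM 1240 (1987), Thm. 1, for `Γ = Γ₁(N)`, `𝒪_K = ℤ`, `λ = (p)`, cruder `SL₂`-index, extra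
restriction `p ∤ N`). Verbatim the tree's Literature fact
`Literature.NumberTheory.ModularForms.Sturm1987_congruenceBound_Gamma1_modPrime` (vendored by this
line, p107838); it closes only by that fact's discharge. [cite: Sturm1987, Thm. 1] -/
theorem stub_sturmModPrime :
    Literature.NumberTheory.ModularForms.Sturm1987_congruenceBound_Gamma1_modPrime := by
  sorry

/-- **Named fact (do not staff) — the unbounded denominators theorem** of Calegari–Dimitrov–Tang,
algebraic-integer form, verbatim the tree's Literature fact
`Literature.NumberTheory.Automorphic.CalegariDimitrovTang2025_unboundedDenominators_algInt`; it closes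
only by that fact's discharge. [cite: CalegariDimitrovTang2025, Remark 58 and Remark 59] -/
theorem stub_unboundedDenominators : CalegariDimitrovTang2025_unboundedDenominators_algInt := by
  sorry

/-- **Sup-norm Sturm bound along `ι` (integral structure of `S_W(Γ₁(N))`).** From Sturm's bound
mod `p` over `ℤ` (`hSturm`, the shape of `stub_sturmModPrime` at this `N, p`) and the fact, PROVED in
the tree, that `S_W(Γ₁(N))` is spanned over `ℂ` by forms with integer q-expansions
(`DeligneSerre1974_span_integralLattice1_holds`): a cusp form `G ∈ S_W(Γ₁(N)) ⊗ ℂ` whose first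
`⌊W·[SL₂(ℤ):Γ₁(N)]/12⌋ + 1` coefficients are `ι`-adically `≤ ε` has ALL coefficients `≤ ε` (the
truncation matrix of a `ℤ`-basis of the integral lattice has a maximal minor prime to `p`; invert it
by the adjugate). -/
theorem stub_supNormOfSturm (p : ℕ) [Fact p.Prime] (N : ℕ) [NeZero N]
    (hSturm : ∀ (k : ℤ) (f : CuspForm (CongruenceSubgroup.Gamma1 N) k) (z : ℕ → ℤ),
      (∀ n : ℕ, coeff n (qExpansion 1 ⇑f) = (z n : ℂ)) →
      (∀ n : ℕ, n ≤ (k * ((CongruenceSubgroup.Gamma1 N).index : ℤ)).toNat / 12 → (p : ℤ) ∣ z n) →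
      ∀ n : ℕ, (p : ℤ) ∣ z n)
    (ι : PadicAlgCl p ≃+* ℂ) (W : ℤ) (G : CuspForm (CongruenceSubgroup.Gamma1 N) W) (ε : ℝ)
    (hε : 0 ≤ ε)
    (hG : ∀ m : ℕ, m ≤ (W * ((CongruenceSubgroup.Gamma1 N).index : ℤ)).toNat / 12 →
      ‖ι.symm (coeff m (qExpansion 1 ⇑G))‖ ≤ ε) :
    ∀ m : ℕ, ‖ι.symm (coeff m (qExpansion 1 ⇑G))‖ ≤ ε :=
  Summit.Langlands.Langlands.Theorems.CapacityClassicality.stub_supNormOfSturm p N hSturm ι W G ε hε hG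

/-- **K1 — Katz–Sturm gain.** Given the sup-norm Sturm bound along `ι` for cusp forms on `Γ₁(N)`
(`hSup`), a complex q-series `F` with a Katz datum `(c_i)` of weight `w`, rate `r > 0`, constant
`C ≥ 0` (classical `c_i ∈ M_{w+i(p-1)}(Γ₁(N))`, `‖ι⁻¹ a_n(c_i)‖ ≤ C p^{-ri}`,
`Σ_i ι⁻¹ a_n(c_i E_{p-1}^{-i}) = ι⁻¹ a_n(F)`) that vanishes below order `M` satisfies
`‖ι⁻¹ a_M(F)‖ ≤ C · p^{(r/(p-1))(w + 12 − 12(M+1)/[SL₂(ℤ):Γ₁(N)])}`. -/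
theorem stub_katzSturm (p : ℕ) [Fact p.Prime] (hp : 5 ≤ p) (N : ℕ) [NeZero N]
    (ι : PadicAlgCl p ≃+* ℂ)
    (hSup : ∀ (W : ℤ) (G : CuspForm (CongruenceSubgroup.Gamma1 N) W) (ε : ℝ), 0 ≤ ε →
      (∀ m : ℕ, m ≤ (W * ((CongruenceSubgroup.Gamma1 N).index : ℤ)).toNat / 12 →
        ‖ι.symm (coeff m (qExpansion 1 ⇑G))‖ ≤ ε) →
      ∀ m : ℕ, ‖ι.symm (coeff m (qExpansion 1 ⇑G))‖ ≤ ε)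
    (w : ℤ) (r C : ℝ) (hr : 0 < r) (hC : 0 ≤ C) (c : ℕ → PowerSeries ℂ) (F : PowerSeries ℂ)
    (hc₁ : ∀ i : ℕ, ∃ G : ModularForm (CongruenceSubgroup.Gamma1 N) (w + i * (p - 1 : ℕ)),
      c i = qExpansion 1 ⇑G)
    (hc₂ : ∀ i n : ℕ, ‖ι.symm (coeff n (c i))‖ ≤ C * (p : ℝ) ^ (-(r * i)))
    (hc₃ : ∀ n : ℕ, HasSum (fun i : ℕ ↦ ι.symm (coeff n
      (c i * ((qExpansion 1 ⇑(ModularForm.E (show 3 ≤ p - 1 by omega)))⁻¹) ^ i)))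
      (ι.symm (coeff n F)))
    (M : ℕ) (hM : ∀ m, m < M → coeff m F = 0) :
    ‖ι.symm (coeff M F)‖ ≤ C * (p : ℝ) ^ (r / ((p : ℝ) - 1) *
      ((w : ℝ) + 12 - 12 * ((M : ℝ) + 1) / ((CongruenceSubgroup.Gamma1 N).index : ℝ))) :=
  Summit.Langlands.Langlands.Theorems.CapacityClassicality.stub_katzSturm p hp N ι hSup w r C hr hC c F hc₁ hc₂ hc₃ M hM

/-- **K4 — Katz data for the auxiliary forms, and the resulting gain.** From the crux's Katz datum
for `g = Σ σ₀(aₙ)qⁿ` (weight `k`, rate `r`, constant `C`) and the Katz–Sturm gain in the shape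
proved by `stub_katzSturm` (`hKS`), every auxiliary form
`F_P = Σ P_{ij} E₄^{3i} Δ^{D₁-i} (g¹² Δ^{k⁻})ʲ (Δ^{k⁺})^{D₂-j}` (`P_{ij} ∈ 𝓞_E`) vanishing below order
`M` has `‖ι⁻¹σ₀ a_M(F_P)‖ ≤ A · B^{D₁+D₂} · R⁻¹^M` for constants `A > 0`, `B ≥ 1`, `R > 1`
independent of `P`, `M`. Here `Z₁, Z₂ ∈ ℤ⟦q⟧` are the q-expansions of `E₄³` and `Δ`. -/
theorem stub_katzGain (p : ℕ) [Fact p.Prime] (hp : 5 ≤ p) (N : ℕ) [NeZero N]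
    (k : ℤ) (ι : PadicAlgCl p ≃+* ℂ) (E : Type) [Field E] [NumberField E] (σ₀ : E →+* ℂ)
    (a : ℕ → E) (hint : ∀ n, IsIntegral ℤ (a n))
    (r C : ℝ) (c : ℕ → PowerSeries ℂ) (hr : 0 < r)
    (hc₁ : ∀ i : ℕ, ∃ F : ModularForm (CongruenceSubgroup.Gamma1 N) (k + i * (p - 1 : ℕ)),
      c i = qExpansion 1 ⇑F)
    (hc₂ : ∀ i n : ℕ, ‖ι.symm (coeff n (c i))‖ ≤ C * (p : ℝ) ^ (-(r * i)))
    (hc₃ : ∀ n : ℕ, HasSum (fun i : ℕ ↦ ι.symm (coeff n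
      (c i * ((qExpansion 1 ⇑(ModularForm.E (show 3 ≤ p - 1 by omega)))⁻¹) ^ i)))
      (ι.symm (σ₀ (a n))))
    (Z₁ Z₂ : PowerSeries ℤ)
    (hZ₁ : Z₁.map (Int.castRingHom ℂ) = (qExpansion 1 ⇑ModularForm.E₄) ^ 3)
    (hZ₂ : Z₂.map (Int.castRingHom ℂ) = qExpansion 1 ⇑CuspForm.discriminant)
    (hKS : ∀ (w : ℤ) (C' : ℝ) (c' : ℕ → PowerSeries ℂ) (F : PowerSeries ℂ), 0 ≤ C' →
      (∀ i : ℕ, ∃ G : ModularForm (CongruenceSubgroup.Gamma1 N) (w + i * (p - 1 : ℕ)),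
        c' i = qExpansion 1 ⇑G) →
      (∀ i n : ℕ, ‖ι.symm (coeff n (c' i))‖ ≤ C' * (p : ℝ) ^ (-(r * i))) →
      (∀ n : ℕ, HasSum (fun i : ℕ ↦ ι.symm (coeff n
        (c' i * ((qExpansion 1 ⇑(ModularForm.E (show 3 ≤ p - 1 by omega)))⁻¹) ^ i)))
        (ι.symm (coeff n F))) →
      ∀ M : ℕ, (∀ m, m < M → coeff m F = 0) →
        ‖ι.symm (coeff M F)‖ ≤ C' * (p : ℝ) ^ (r / ((p : ℝ) - 1) *
          ((w : ℝ) + 12 - 12 * ((M : ℝ) + 1) / ((CongruenceSubgroup.Gamma1 N).index : ℝ)))) :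
    ∃ A B R : ℝ, 0 < A ∧ 1 ≤ B ∧ 1 < R ∧
      ∀ (D₁ D₂ : ℕ) (P : Fin (D₁ + 1) → Fin (D₂ + 1) → E), (∀ i j, IsIntegral ℤ (P i j)) →
      ∀ M : ℕ,
        (∀ m, m < M → coeff m (∑ i : Fin (D₁ + 1), ∑ j : Fin (D₂ + 1),
          PowerSeries.C (P i j) * (Z₁.map (Int.castRingHom E)) ^ (i : ℕ) *
            (Z₂.map (Int.castRingHom E)) ^ (D₁ - i) *
            ((PowerSeries.mk a) ^ 12 * (Z₂.map (Int.castRingHom E)) ^ (-k).toNat) ^ (j : ℕ) *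
            ((Z₂.map (Int.castRingHom E)) ^ k.toNat) ^ (D₂ - j)) = 0) →
        ‖ι.symm (σ₀ (coeff M (∑ i : Fin (D₁ + 1), ∑ j : Fin (D₂ + 1),
          PowerSeries.C (P i j) * (Z₁.map (Int.castRingHom E)) ^ (i : ℕ) *
            (Z₂.map (Int.castRingHom E)) ^ (D₁ - i) *
            ((PowerSeries.mk a) ^ 12 * (Z₂.map (Int.castRingHom E)) ^ (-k).toNat) ^ (j : ℕ) *
            ((Z₂.map (Int.castRingHom E)) ^ k.toNat) ^ (D₂ - j))))‖
          ≤ A * B ^ (D₁ + D₂) * R⁻¹ ^ M :=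
  Summit.Langlands.Langlands.Theorems.CapacityClassicality.stub_katzGain p hp N k ι E σ₀ a hint r C c hr hc₁ hc₂ hc₃ Z₁ Z₂ hZ₁ hZ₂ hKS

/-- **Transcendence core (auxiliary polynomial; the lead's stub).** Over a number field `E` with a
`p`-adic embedding `v`, let `x₁, x₂, g ∈ E⟦q⟧` have algebraic-integer coefficients and radius of
convergence `≥ 1` under every complex embedding. If every auxiliary combination
`F_P = Σ P_{ij} x₁ⁱ x₂^{D₁-i} (g¹² x₂^{k₂})ʲ (x₂^{k₁})^{D₂-j}` with `P_{ij} ∈ 𝓞_E` enjoys the `v`-adic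
gain `‖v(a_M(F_P))‖ ≤ A B^{D₁+D₂} R^{-M}` at its vanishing order `M` (`R > 1`), then some `P ≠ 0`
has `F_P = 0` (Siegel's lemma over `𝓞_E`, trivial coefficient estimates at the archimedean
places, and the Liouville inequality `1 ≤ ∏_σ |σ α| · ‖v α‖` for `0 ≠ α ∈ 𝓞_E`). -/
theorem stub_auxPoly (E : Type) [Field E] [NumberField E] (p : ℕ) [Fact p.Prime]
    (v : E →+* PadicAlgCl p) (x₁ x₂ g : PowerSeries E) (k₁ k₂ : ℕ)
    (hx₁ : ∀ n, IsIntegral ℤ (coeff n x₁)) (hx₂ : ∀ n, IsIntegral ℤ (coeff n x₂))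
    (hg : ∀ n, IsIntegral ℤ (coeff n g))
    (hrx₁ : ∀ (σ : E →+* ℂ) (t : ℝ), 0 < t → t < 1 → ∃ K : ℝ, ∀ n, ‖σ (coeff n x₁)‖ * t ^ n ≤ K)
    (hrx₂ : ∀ (σ : E →+* ℂ) (t : ℝ), 0 < t → t < 1 → ∃ K : ℝ, ∀ n, ‖σ (coeff n x₂)‖ * t ^ n ≤ K)
    (hrg : ∀ (σ : E →+* ℂ) (t : ℝ), 0 < t → t < 1 → ∃ K : ℝ, ∀ n, ‖σ (coeff n g)‖ * t ^ n ≤ K)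
    (A B R : ℝ) (hA : 0 < A) (hB : 1 ≤ B) (hR : 1 < R)
    (hgain : ∀ (D₁ D₂ : ℕ) (P : Fin (D₁ + 1) → Fin (D₂ + 1) → E),
      (∀ i j, IsIntegral ℤ (P i j)) → ∀ M : ℕ,
        (∀ m, m < M → coeff m (∑ i : Fin (D₁ + 1), ∑ j : Fin (D₂ + 1),
          PowerSeries.C (P i j) * x₁ ^ (i : ℕ) * x₂ ^ (D₁ - i) * (g ^ 12 * x₂ ^ k₂) ^ (j : ℕ) *
            (x₂ ^ k₁) ^ (D₂ - j)) = 0) →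
        ‖v (coeff M (∑ i : Fin (D₁ + 1), ∑ j : Fin (D₂ + 1),
          PowerSeries.C (P i j) * x₁ ^ (i : ℕ) * x₂ ^ (D₁ - i) * (g ^ 12 * x₂ ^ k₂) ^ (j : ℕ) *
            (x₂ ^ k₁) ^ (D₂ - j)))‖ ≤ A * B ^ (D₁ + D₂) * R⁻¹ ^ M) :
    ∃ (D₁ D₂ : ℕ) (P : Fin (D₁ + 1) → Fin (D₂ + 1) → E), P ≠ 0 ∧
      (∑ i : Fin (D₁ + 1), ∑ j : Fin (D₂ + 1),
          PowerSeries.C (P i j) * x₁ ^ (i : ℕ) * x₂ ^ (D₁ - i) * (g ^ 12 * x₂ ^ k₂) ^ (j : ℕ) *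
            (x₂ ^ k₁) ^ (D₂ - j)) = 0 :=
  Summit.Langlands.Langlands.Theorems.CapacityClassicality.stub_auxPoly E p v x₁ x₂ g k₁ k₂ hx₁ hx₂ hg hrx₁ hrx₂ hrg A B R hA hB hR hgain

/-- **Analytic packaging.** For complex coefficients `b` of radius `≥ 1`, the q-series
`g(τ) = Σ bₙ qⁿ` is holomorphic and `1`-periodic on `ℍ` with `qExpansion 1 g = Σ bₙ qⁿ`;
`y := g¹²/Δᵏ` is holomorphic and `1`-periodic; the q-expansions of `E₄³` and `Δ` have radius
`≥ 1`; and a q-SERIES identity `Σ c_{ij} X₁ⁱ X₂^{D₁-i} (G¹²X₂^{k⁻})ʲ (X₂^{k⁺})^{D₂-j} = 0`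
(`X₁ = qExp(E₄)³`, `X₂ = qExp(Δ)`, `G = Σ bₙqⁿ`) becomes the FUNCTION identity
`Σ c_{ij} j(τ)ⁱ y(τ)ʲ = 0` on `ℍ` (`j = E₄³/Δ = kleinJ`). -/
theorem stub_analyticPackaging (b : ℕ → ℂ)
    (hb : ∀ t : ℝ, 0 < t → t < 1 → ∃ K : ℝ, ∀ n, ‖b n‖ * t ^ n ≤ K) (k : ℤ) :
    MDifferentiable 𝓘(ℂ, ℂ) 𝓘(ℂ, ℂ)
        (fun τ : ℍ ↦ ∑' n : ℕ, b n * Function.Periodic.qParam 1 (τ : ℂ) ^ n) ∧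
      (∀ τ : ℍ, (∑' n : ℕ, b n * Function.Periodic.qParam 1 (((1 : ℝ) +ᵥ τ : ℍ) : ℂ) ^ n) =
        ∑' n : ℕ, b n * Function.Periodic.qParam 1 (τ : ℂ) ^ n) ∧
      (∀ τ : ℍ, HasSum (fun n : ℕ ↦ b n * Function.Periodic.qParam 1 (τ : ℂ) ^ n)
        (∑' n : ℕ, b n * Function.Periodic.qParam 1 (τ : ℂ) ^ n)) ∧
      qExpansion 1 (fun τ : ℍ ↦ ∑' n : ℕ, b n * Function.Periodic.qParam 1 (τ : ℂ) ^ n) =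
        PowerSeries.mk b ∧
      MDifferentiable 𝓘(ℂ, ℂ) 𝓘(ℂ, ℂ)
        (fun τ : ℍ ↦ (∑' n : ℕ, b n * Function.Periodic.qParam 1 (τ : ℂ) ^ n) ^ 12 /
          ModularForm.discriminant τ ^ k) ∧
      (∀ τ : ℍ, (∑' n : ℕ, b n * Function.Periodic.qParam 1 (((1 : ℝ) +ᵥ τ : ℍ) : ℂ) ^ n) ^ 12 /
          ModularForm.discriminant ((1 : ℝ) +ᵥ τ) ^ k =
        (∑' n : ℕ, b n * Function.Periodic.qParam 1 (τ : ℂ) ^ n) ^ 12 /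
          ModularForm.discriminant τ ^ k) ∧
      (∀ t : ℝ, 0 < t → t < 1 → ∃ K : ℝ, ∀ n,
        ‖coeff n ((qExpansion 1 ⇑ModularForm.E₄) ^ 3)‖ * t ^ n ≤ K) ∧
      (∀ t : ℝ, 0 < t → t < 1 → ∃ K : ℝ, ∀ n,
        ‖coeff n (qExpansion 1 ⇑CuspForm.discriminant)‖ * t ^ n ≤ K) ∧
      ∀ (D₁ D₂ : ℕ) (c : Fin (D₁ + 1) → Fin (D₂ + 1) → ℂ),
        (∑ i : Fin (D₁ + 1), ∑ j : Fin (D₂ + 1),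
          PowerSeries.C (c i j) * ((qExpansion 1 ⇑ModularForm.E₄) ^ 3) ^ (i : ℕ) *
            (qExpansion 1 ⇑CuspForm.discriminant) ^ (D₁ - i) *
            ((PowerSeries.mk b) ^ 12 * (qExpansion 1 ⇑CuspForm.discriminant) ^ (-k).toNat) ^ (j : ℕ) *
            ((qExpansion 1 ⇑CuspForm.discriminant) ^ k.toNat) ^ (D₂ - j)) = 0 →
        ∀ τ : ℍ, ∑ i : Fin (D₁ + 1), ∑ j : Fin (D₂ + 1),
          c i j * kleinJ τ ^ (i : ℕ) *
            ((∑' n : ℕ, b n * Function.Periodic.qParam 1 (τ : ℂ) ^ n) ^ 12 /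
              ModularForm.discriminant τ ^ k) ^ (j : ℕ) = 0 :=
  Summit.Langlands.Langlands.Theorems.CapacityClassicality.stub_analyticPackaging b hb k

/-- **Monodromy.** A holomorphic `1`-periodic function `y` on `ℍ` that satisfies a non-trivial
polynomial relation `Σ c_{ij} j(τ)ⁱ y(τ)ʲ = 0` with Klein's `j` is invariant under a finite-index
subgroup `Γ' ∋ T` of `SL₂(ℤ)`, and all its translates `y ∘ γ` grow at most exponentially in `Im τ`
(uniformly in `γ ∈ SL₂(ℤ)`): the holomorphic roots of the relation are finitely many, permuted by
`SL₂(ℤ)`, and bounded by Cauchy's root bound in terms of `|j| ≍ e^{2π Im τ}`. -/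
theorem stub_monodromy (y : ℍ → ℂ) (hy : MDifferentiable 𝓘(ℂ, ℂ) 𝓘(ℂ, ℂ) y)
    (hper : ∀ τ : ℍ, y ((1 : ℝ) +ᵥ τ) = y τ)
    (D₁ D₂ : ℕ) (c : Fin (D₁ + 1) → Fin (D₂ + 1) → ℂ) (hc : c ≠ 0)
    (hrel : ∀ τ : ℍ, ∑ i : Fin (D₁ + 1), ∑ j : Fin (D₂ + 1),
      c i j * kleinJ τ ^ (i : ℕ) * y τ ^ (j : ℕ) = 0) :
    ∃ Γ' : Subgroup SL(2, ℤ), Γ'.FiniteIndex ∧ ModularGroup.T ∈ Γ' ∧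
      (∀ γ ∈ Γ', ∀ τ : ℍ, y (γ • τ) = y τ) ∧
      ∃ A K T₀ : ℝ, ∀ (γ : SL(2, ℤ)) (τ : ℍ), T₀ ≤ τ.im → ‖y (γ • τ)‖ ≤ K * Real.exp (A * τ.im) :=
  Summit.Langlands.Langlands.Theorems.CapacityClassicality.stub_monodromy y hy hper D₁ D₂ c hc hrel

/-- **From invariance to a modular form.** Let `g = Σ bₙqⁿ` be holomorphic and `1`-periodic on `ℍ`
and suppose `y = g¹²/Δᵏ` is invariant under a finite-index `Γ' ∋ T` with all `SL₂(ℤ)`-translates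
of exponential growth. Then `g|_kγ = ζ_γ g` (`ζ_γ¹² = 1`) on `Γ'`, the kernel `Γ''` of `ζ` has finite
index and contains `T`, and for `m` large `g·Δᵐ` is a `ModularForm Γ'' (k + 12m)` whose q-expansion
is `(Σ bₙqⁿ)·Δᵐ`. -/
theorem stub_modularOfInvariant (b : ℕ → ℂ) (k : ℤ)
    (hg : MDifferentiable 𝓘(ℂ, ℂ) 𝓘(ℂ, ℂ)
      (fun τ : ℍ ↦ ∑' n : ℕ, b n * Function.Periodic.qParam 1 (τ : ℂ) ^ n))
    (hgper : ∀ τ : ℍ, (∑' n : ℕ, b n * Function.Periodic.qParam 1 (((1 : ℝ) +ᵥ τ : ℍ) : ℂ) ^ n) =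
      ∑' n : ℕ, b n * Function.Periodic.qParam 1 (τ : ℂ) ^ n)
    (hgsum : ∀ τ : ℍ, HasSum (fun n : ℕ ↦ b n * Function.Periodic.qParam 1 (τ : ℂ) ^ n)
      (∑' n : ℕ, b n * Function.Periodic.qParam 1 (τ : ℂ) ^ n))
    (hgq : qExpansion 1 (fun τ : ℍ ↦ ∑' n : ℕ, b n * Function.Periodic.qParam 1 (τ : ℂ) ^ n) =
      PowerSeries.mk b)
    (Γ' : Subgroup SL(2, ℤ)) [Γ'.FiniteIndex] (hT : ModularGroup.T ∈ Γ')
    (hinv : ∀ γ ∈ Γ', ∀ τ : ℍ,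
      (∑' n : ℕ, b n * Function.Periodic.qParam 1 ((γ • τ : ℍ) : ℂ) ^ n) ^ 12 /
          ModularForm.discriminant (γ • τ) ^ k =
        (∑' n : ℕ, b n * Function.Periodic.qParam 1 (τ : ℂ) ^ n) ^ 12 /
          ModularForm.discriminant τ ^ k)
    (A K T₀ : ℝ)
    (hgrowth : ∀ (γ : SL(2, ℤ)) (τ : ℍ), T₀ ≤ τ.im →
      ‖(∑' n : ℕ, b n * Function.Periodic.qParam 1 ((γ • τ : ℍ) : ℂ) ^ n) ^ 12 /
          ModularForm.discriminant (γ • τ) ^ k‖ ≤ K * Real.exp (A * τ.im)) :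
    ∃ (Γ'' : Subgroup SL(2, ℤ)) (_ : Γ''.FiniteIndex) (m : ℕ)
      (f : ModularForm (Γ'' : Subgroup (GL (Fin 2) ℝ)) (k + 12 * m)),
      ModularGroup.T ∈ Γ'' ∧
        qExpansion 1 ⇑f = PowerSeries.mk b * (qExpansion 1 ⇑CuspForm.discriminant) ^ m :=
  Summit.Langlands.Langlands.Theorems.CapacityClassicality.stub_modularOfInvariant b k hg hgper hgsum hgq Γ' hT hinv A K T₀ hgrowth

/-- **Congruence endgame.** Assuming Calegari–Dimitrov–Tang's unbounded denominators theorem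
(algebraic-integer form), a modular form `f` on a finite-index `Γ ∋ T` whose q-expansion is
`(Σ σ₀(aₙ)qⁿ)·Δᵐ` with `aₙ` algebraic integers is (the function of) a modular form of the same
weight on `Γ₁(M)` for some `M ≥ 1`: CDT gives a congruence level `Γ' ⊇ Γ(M)` carrying `f`, and
`f(τ + 1) = f(τ)` upgrades `Γ(M)` to `⟨Γ(M), T⟩ = Γ₁(M)`. -/
theorem stub_congruenceEndgame (hCDT : CalegariDimitrovTang2025_unboundedDenominators_algInt)
    {E : Type} [Field E] (σ₀ : E →+* ℂ) (a : ℕ → E) (hint : ∀ n, IsIntegral ℤ (a n))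
    (Γ : Subgroup SL(2, ℤ)) [Γ.FiniteIndex] (hT : ModularGroup.T ∈ Γ) (k : ℤ) (m : ℕ)
    (f : ModularForm (Γ : Subgroup (GL (Fin 2) ℝ)) k)
    (hqf : qExpansion 1 ⇑f =
      PowerSeries.mk (fun n ↦ σ₀ (a n)) * (qExpansion 1 ⇑CuspForm.discriminant) ^ m) :
    ∃ (M : ℕ) (_ : NeZero M) (F : ModularForm (CongruenceSubgroup.Gamma1 M) k),
      qExpansion 1 ⇑F = qExpansion 1 ⇑f :=
  Summit.Langlands.Langlands.Theorems.CapacityClassicality.stub_congruenceEndgame hCDT σ₀ a hint Γ hT k m f hqf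

/-! ## Composition -/

/-- **Composition of the line.** The crux `IntegralOverconvergentIsCongruence` follows from the
eight provable stubs above together with the two named facts `stub_sturmModPrime` (Sturm 1987,
Thm 1, mod `p` over `ℤ`) and `stub_unboundedDenominators` (Calegari–Dimitrov–Tang). No other
hypothesis. -/
theorem IntegralOverconvergentIsCongruence_of :
    Summit.Langlands.Langlands.Theses.CapacityClassicality.IntegralOverconvergentIsCongruence := by
  intro p _ hp N _ hpN k ι E _ _ σ₀ a hint hrad hKatz
  obtain ⟨r, C, c, hr, hc₁, hc₂, hc₃⟩ := hKatz
  -- the two named facts of the line, and the sup-norm Sturm bound along `ι`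
  have hCDT : CalegariDimitrovTang2025_unboundedDenominators_algInt := stub_unboundedDenominators
  have hSup := stub_supNormOfSturm p N (stub_sturmModPrime N p Fact.out hpN) ι
  -- integer models of the q-expansions of `E₄³` and `Δ`
  obtain ⟨Z₁, hZ₁⟩ : ∃ Z₁ : PowerSeries ℤ,
      Z₁.map (Int.castRingHom ℂ) = (qExpansion 1 ⇑ModularForm.E₄) ^ 3 :=
    ⟨formalE4 ^ 3, by rw [map_pow, qExpansion_E₄]⟩
  obtain ⟨Z₂, hZ₂⟩ : ∃ Z₂ : PowerSeries ℤ,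
      Z₂.map (Int.castRingHom ℂ) = qExpansion 1 ⇑CuspForm.discriminant :=
    ⟨PowerSeries.X * formalDeltaUnit, by
      rw [CuspForm.coe_discriminant]; exact qExpansion_discriminant.symm⟩
  -- K1 + K4: the `𝔭`-adic gain for every auxiliary form
  have hKS := stub_katzSturm p hp N ι hSup
  obtain ⟨A, B, R, hA, hB, hR, hgain⟩ := stub_katzGain p hp N k ι E σ₀ a hint r C c hr hc₁ hc₂
    hc₃ Z₁ Z₂ hZ₁ hZ₂
    (fun w C' c' F hC' h₁ h₂ h₃ M hM ↦ hKS w r C' hr hC' c' F h₁ h₂ h₃ M hM)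
  -- analytic packaging at the distinguished embedding `σ₀`
  obtain ⟨hghol, hgper, hgsum, hgq, hyhol, hyper, hradE4, hradΔ, htransfer⟩ :=
    stub_analyticPackaging (fun n ↦ σ₀ (a n)) (hrad σ₀) k
  -- hypotheses of the transcendence core
  have hmapσ : ∀ (σ : E →+* ℂ) (Z : PowerSeries ℤ) (n : ℕ),
      σ (coeff n (Z.map (Int.castRingHom E))) = coeff n (Z.map (Int.castRingHom ℂ)) := by
    intro σ Z n
    simp [PowerSeries.coeff_map]
  have hintZ : ∀ (Z : PowerSeries ℤ) (n : ℕ), IsIntegral ℤ (coeff n (Z.map (Int.castRingHom E))) := by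
    intro Z n
    rw [PowerSeries.coeff_map, ← algebraMap_int_eq]
    exact isIntegral_algebraMap
  have hgi : ∀ n, IsIntegral ℤ (coeff n (PowerSeries.mk a)) := fun n ↦ by
    simpa using hint n
  have hrx₁ : ∀ (σ : E →+* ℂ) (t : ℝ), 0 < t → t < 1 →
      ∃ K : ℝ, ∀ n, ‖σ (coeff n (Z₁.map (Int.castRingHom E)))‖ * t ^ n ≤ K := by
    intro σ t ht ht1
    obtain ⟨K, hK⟩ := hradE4 t ht ht1
    exact ⟨K, fun n ↦ by rw [hmapσ, hZ₁]; exact hK n⟩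
  have hrx₂ : ∀ (σ : E →+* ℂ) (t : ℝ), 0 < t → t < 1 →
      ∃ K : ℝ, ∀ n, ‖σ (coeff n (Z₂.map (Int.castRingHom E)))‖ * t ^ n ≤ K := by
    intro σ t ht ht1
    obtain ⟨K, hK⟩ := hradΔ t ht ht1
    exact ⟨K, fun n ↦ by rw [hmapσ, hZ₂]; exact hK n⟩
  have hrg : ∀ (σ : E →+* ℂ) (t : ℝ), 0 < t → t < 1 →
      ∃ K : ℝ, ∀ n, ‖σ (coeff n (PowerSeries.mk a))‖ * t ^ n ≤ K := by
    intro σ t ht ht1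
    simpa using hrad σ t ht ht1
  -- transcendence core: a non-trivial bihomogeneous relation over `E`
  obtain ⟨D₁, D₂, P, hP0, hFP⟩ := stub_auxPoly E p
    ((ι.symm : ℂ ≃+* PadicAlgCl p).toRingHom.comp σ₀)
    (Z₁.map (Int.castRingHom E)) (Z₂.map (Int.castRingHom E)) (PowerSeries.mk a)
    k.toNat (-k).toNat (hintZ Z₁) (hintZ Z₂) hgi hrx₁ hrx₂ hrg A B R hA hB hR
    (fun D₁ D₂ P hP M hM ↦ by simpa using hgain D₁ D₂ P hP M hM)
  -- transport the relation to complex q-series along `σ₀`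
  have hmapZ : ∀ Z : PowerSeries ℤ,
      (Z.map (Int.castRingHom E)).map σ₀ = Z.map (Int.castRingHom ℂ) := by
    intro Z
    rw [← RingHom.comp_apply (PowerSeries.map σ₀), ← PowerSeries.map_comp,
      RingHom.ext_int (σ₀.comp (Int.castRingHom E)) (Int.castRingHom ℂ)]
  have hmapg : (PowerSeries.mk a).map σ₀ = PowerSeries.mk (fun n ↦ σ₀ (a n)) := by
    ext n
    simp [PowerSeries.coeff_map]
  have hFPC := congrArg (PowerSeries.map σ₀) hFP
  simp only [map_sum, map_mul, map_pow, PowerSeries.map_C, hmapZ, hZ₁, hZ₂, hmapg, map_zero]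
    at hFPC
  have hc0 : (fun i j ↦ σ₀ (P i j)) ≠ 0 := by
    intro h
    apply hP0
    funext i j
    have hij := congrFun (congrFun h i) j
    simp only [Pi.zero_apply] at hij
    exact (map_eq_zero_iff σ₀ σ₀.injective).mp hij
  have hrel := htransfer D₁ D₂ (fun i j ↦ σ₀ (P i j)) hFPC
  -- monodromy: finite-index invariance of `y = g¹²/Δᵏ` and growth of its translates
  obtain ⟨Γ', hΓ', hT', hinv, A', K', T₀, hgrowth⟩ := stub_monodromy
    (fun τ : ℍ ↦ (∑' n : ℕ, σ₀ (a n) * Function.Periodic.qParam 1 (τ : ℂ) ^ n) ^ 12 /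
      ModularForm.discriminant τ ^ k)
    hyhol hyper D₁ D₂ (fun i j ↦ σ₀ (P i j)) hc0 hrel
  haveI := hΓ'
  -- `g Δᵐ` is a modular form on a finite-index `Γ'' ∋ T`
  obtain ⟨Γ'', hΓ'', m, f, hT'', hqf⟩ := stub_modularOfInvariant (fun n ↦ σ₀ (a n)) k hghol hgper
    hgsum hgq Γ' hT' hinv A' K' T₀ hgrowth
  haveI := hΓ''
  -- endgame: Calegari–Dimitrov–Tang + `⟨Γ(M), T⟩ = Γ₁(M)`
  obtain ⟨M, hM, F, hF⟩ := stub_congruenceEndgame hCDT σ₀ a hint Γ'' hT'' (k + 12 * m) m f hqf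
  exact ⟨M, hM, m, F, hF.trans hqf⟩

end Summit.Langlands.Langlands.Cruxes.IntegralOverconvergentIsCongruence.Sketch

end
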